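import Summits.CriticalPhenomena.CardyFormulaZ2.Theorems.CardySelfDualSegmentUniformMarginalityDefs

/-!
# Worker stub `integral_russoIntegrand_eq_half_pivotal_sub` of line `Sketch` for the crux
`UniformMarginality` (stmt-CriticalPhenomena-5472): the Russo integrand integrated out over
the fair coin

For every `t ∈ [0,1]`, every measurable event `A` and every vertex `v`, with `E = eastEdge v`,
`N = northEdge v` and `M_t = cornerPercolation t`,
`∫ (1 − 2·𝟙{E ∈ ω}) 𝟙{N pivotal for A in ω} dM_t(ω)
  = ½ (M_t{ω | N pivotal for A in ω \ {E}} − M_t{ω | N pivotal for A in insert E ω})`.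

Proof. Split on the state of `E`: on `{E ∉ ω}` one has `ω = ω \ {E}`, on `{E ∈ ω}` one has
`ω = insert E ω`, so the integrand is `𝟙({E ∉ ω} ∩ G₀) − 𝟙({E ∈ ω} ∩ G₁)` with
`G₀ = {N pivotal in ω \ {E}}`, `G₁ = {N pivotal in insert E ω}`
(`russoIntegrand_eq_indicator_sub`). Through the coding `cornerConfig` of `M_t` by the coin
space (`cornerPercolation_real_apply`), `{E ∈ ω}` pulls back to the fair coin `{(v,0) ∈ S}`
(`east_mem_cornerConfig_iff`, `cornerParam_apply_zero`), while `G₀`, `G₁` pull back to events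
not depending on the coordinate `(v,0)`: pivotality of `N` never reads `N`, the state of `E`
has been forced, and every other edge of `cornerConfig S` only reads coordinates `≠ (v,0)`
(`determinedBy_pivotal_sdiff`, `determinedBy_pivotal_insert`). Independence of events
determined by disjoint coordinate sets under `prodBernoulli`
(`prodBernoulli_real_inter_of_determinedBy`, `prodBernoulli_real_setOf_mem`,
`prodBernoulli_real_setOf_notMem`) gives `M_t({E ∉ ω} ∩ G₀) = ½ M_t(G₀)` and
`M_t({E ∈ ω} ∩ G₁) = ½ M_t(G₁)`.
-/

namespace Summit.CriticalPhenomena.CardyFormulaZ2.Cruxes.UniformMarginality.HeatFlow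

open MeasureTheory Literature.Probability.Percolation Literature.Probability.LatticeModels
  Literature.Probability.RandomPlanarGeometry
open scoped Classical

/-! ## §1 Measurability and pivotality on configuration spaces `Set α` -/

section SetSpace

variable {α : Type*}

/-- Switching a coordinate on is measurable. -/
private theorem measurable_insert_mi (a : α) : Measurable (insert a : Set α → Set α) :=
  measurable_set_iff.2 fun x => by
    simp only [Set.mem_insert_iff]
    exact measurable_const.or (measurable_set_mem x)

/-- Switching a coordinate off is measurable. -/
private theorem measurable_sdiff_singleton_mi (a : α) : Measurable (· \ {a} : Set α → Set α) :=
  measurable_set_iff.2 fun x => (measurable_set_mem x).and measurable_const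

/-- The pivotality event of a measurable event is measurable. -/
private theorem measurableSet_isPivotal_mi {A : Set (Set α)} (hA : MeasurableSet A) (a : α) :
    MeasurableSet {S : Set α | IsPivotal A a S} := by
  have h1 : MeasurableSet {S : Set α | insert a S ∈ A} := measurable_insert_mi a hA
  have h2 : MeasurableSet {S : Set α | S \ {a} ∈ A} := measurable_sdiff_singleton_mi a hA
  have h : {S : Set α | IsPivotal A a S} = ({S | insert a S ∈ A} ∩ {S | S \ {a} ∈ A}ᶜ) ∪
      ({S | S \ {a} ∈ A} ∩ {S | insert a S ∈ A}ᶜ) := by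
    ext S
    simp only [IsPivotal, Xor, Set.mem_setOf_eq, Set.mem_union, Set.mem_inter_iff,
      Set.mem_compl_iff]
  rw [h]
  exact (h1.inter h2.compl).union (h2.inter h1.compl)

/-- The event "`a` is pivotal once `b` has been switched off" is measurable. -/
private theorem measurableSet_isPivotal_sdiff_mi {A : Set (Set α)} (hA : MeasurableSet A)
    (a b : α) : MeasurableSet {S : Set α | IsPivotal A a (S \ {b})} :=
  measurable_sdiff_singleton_mi b (measurableSet_isPivotal_mi hA a)

/-- The event "`a` is pivotal once `b` has been switched on" is measurable. -/
private theorem measurableSet_isPivotal_insert_mi {A : Set (Set α)} (hA : MeasurableSet A)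
    (a b : α) : MeasurableSet {S : Set α | IsPivotal A a (insert b S)} :=
  measurable_insert_mi b (measurableSet_isPivotal_mi hA a)

/-- Pivotality of `e` does not see the state of `e`: configurations agreeing off `e` agree on
`{e pivotal}`. -/
private theorem isPivotal_congr_off_mi (A : Set (Set α)) {e : α} {ω ω' : Set α}
    (h : ∀ x, x ≠ e → (x ∈ ω ↔ x ∈ ω')) : IsPivotal A e ω ↔ IsPivotal A e ω' := by
  have h1 : insert e ω = insert e ω' := by
    ext x
    by_cases hx : x = e
    · subst hx; simp
    · simp [hx, h x hx]
  have h2 : ω \ {e} = ω' \ {e} := by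
    ext x
    by_cases hx : x = e
    · subst hx; simp
    · simp [hx, h x hx]
  unfold IsPivotal
  rw [h1, h2]

/-- `∫ (𝟙_B − 𝟙_C) dν = ν(B) − ν(C)` for measurable `B`, `C` and a finite measure `ν`. -/
private theorem integral_indicator_one_sub_mi (ν : Measure (Set α)) [IsFiniteMeasure ν]
    {B C : Set (Set α)} (hB : MeasurableSet B) (hC : MeasurableSet C) :
    ∫ ω, (B.indicator (1 : Set α → ℝ) ω - C.indicator (1 : Set α → ℝ) ω) ∂ν =
      ν.real B - ν.real C := by
  have hiB : Integrable (B.indicator (1 : Set α → ℝ)) ν := (integrable_const (1 : ℝ)).indicator hB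
  have hiC : Integrable (C.indicator (1 : Set α → ℝ)) ν := (integrable_const (1 : ℝ)).indicator hC
  rw [integral_sub hiB hiC, integral_indicator_one hB, integral_indicator_one hC]

end SetSpace

/-! ## §2 The integrand split on the state of the east edge -/

/-- **The Russo integrand split on the state of `E_v`**:
`X_v = 𝟙({E_v ∉ ω} ∩ {N_v piv in ω \ {E_v}}) − 𝟙({E_v ∈ ω} ∩ {N_v piv in insert E_v ω})`
(on `{E_v ∉ ω}`, `ω \ {E_v} = ω`; on `{E_v ∈ ω}`, `insert E_v ω = ω`). -/
private theorem russoIntegrand_eq_indicator_sub (A : Set (BondConfig (Site 2))) (v : Site 2)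
    (ω : BondConfig (Site 2)) :
    russoIntegrand A v ω =
      ({ω | eastEdge v ∉ ω} ∩ {ω | IsPivotal A (northEdge v) (ω \ {eastEdge v})}).indicator
          (1 : BondConfig (Site 2) → ℝ) ω -
        ({ω | eastEdge v ∈ ω} ∩ {ω | IsPivotal A (northEdge v) (insert (eastEdge v) ω)}).indicator
          (1 : BondConfig (Site 2) → ℝ) ω := by
  unfold russoIntegrand
  by_cases hE : eastEdge v ∈ ω
  · have hins : insert (eastEdge v) ω = ω := Set.insert_eq_of_mem hE
    simp only [Set.indicator_apply, Set.mem_inter_iff, Set.mem_setOf_eq, hE, hins,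
      not_true_eq_false, false_and, if_false, true_and, Pi.one_apply, if_true]
    by_cases hp : IsPivotal A (northEdge v) ω <;> simp [hp]
  · have hsd : ω \ {eastEdge v} = ω := Set.sdiff_singleton_eq_self hE
    simp only [Set.indicator_apply, Set.mem_inter_iff, Set.mem_setOf_eq, hE, hsd,
      not_false_eq_true, true_and, false_and, if_false, Pi.one_apply]
    by_cases hp : IsPivotal A (northEdge v) ω <;> simp [hp]

/-! ## §3 Through the coding `cornerConfig`: what does not depend on the coin `(v,0)` -/

/-- Coin sets agreeing off the coin `(v,0)` have corner configurations agreeing off the two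
edges `E_v`, `N_v` of the corner at `v`. -/
private theorem mem_cornerConfig_congr_off_coin {S S' : Set (Site 2 × Fin 2)} {v : Site 2}
    (h : ∀ i, i ≠ (v, (0 : Fin 2)) → (i ∈ S ↔ i ∈ S')) {e : Sym2 (Site 2)}
    (hE : e ≠ eastEdge v) (hN : e ≠ northEdge v) : e ∈ cornerConfig S ↔ e ∈ cornerConfig S' := by
  simp only [mem_cornerConfig_iff]
  refine exists_congr fun w => ?_
  by_cases hw : w = v
  · subst hw
    have hE' : e ≠ s(w, w + ![1, 0]) := hE
    have hN' : e ≠ s(w, w + ![0, 1]) := hN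
    simp only [hE', hN', false_and, or_false]
  · have h0 : (w, (0 : Fin 2)) ∈ S ↔ (w, (0 : Fin 2)) ∈ S' := h _ (by simp [hw])
    have h1 : (w, (1 : Fin 2)) ∈ S ↔ (w, (1 : Fin 2)) ∈ S' := h _ (by simp)
    rw [h0, h1]

/-- Coin sets agreeing on `{(v,0)}ᶜ` agree off `(v,0)`. -/
private theorem forall_iff_of_inter_compl_coin {S S' : Set (Site 2 × Fin 2)} {v : Site 2}
    (h : S ∩ ((↑({(v, (0 : Fin 2))} : Finset (Site 2 × Fin 2)) : Set (Site 2 × Fin 2))ᶜ) =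
      S' ∩ ((↑({(v, (0 : Fin 2))} : Finset (Site 2 × Fin 2)) : Set (Site 2 × Fin 2))ᶜ)) :
    ∀ i, i ≠ (v, (0 : Fin 2)) → (i ∈ S ↔ i ∈ S') := by
  intro i hi
  have := Set.ext_iff.1 h i
  simpa only [Finset.coe_singleton, Set.mem_inter_iff, Set.mem_compl_iff, Set.mem_singleton_iff,
    hi, not_false_eq_true, and_true] using this

/-- Through `cornerConfig`, pivotality of `N_v` with `E_v` forced closed does not depend on the
coin `(v,0)`. -/
private theorem determinedBy_pivotal_sdiff (A : Set (BondConfig (Site 2))) (v : Site 2) :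
    DeterminedBy (cornerConfig ⁻¹' {ω | IsPivotal A (northEdge v) (ω \ {eastEdge v})})
      ((↑({(v, (0 : Fin 2))} : Finset (Site 2 × Fin 2)) : Set (Site 2 × Fin 2))ᶜ) := by
  rw [determinedBy_iff]
  intro S S' hSS'
  simp only [Set.mem_preimage, Set.mem_setOf_eq]
  refine isPivotal_congr_off_mi A fun e he => ?_
  simp only [Set.mem_sdiff, Set.mem_singleton_iff]
  by_cases heE : e = eastEdge v
  · simp [heE]
  · rw [mem_cornerConfig_congr_off_coin (forall_iff_of_inter_compl_coin hSS') heE he]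

/-- Through `cornerConfig`, pivotality of `N_v` with `E_v` forced open does not depend on the
coin `(v,0)`. -/
private theorem determinedBy_pivotal_insert (A : Set (BondConfig (Site 2))) (v : Site 2) :
    DeterminedBy (cornerConfig ⁻¹' {ω | IsPivotal A (northEdge v) (insert (eastEdge v) ω)})
      ((↑({(v, (0 : Fin 2))} : Finset (Site 2 × Fin 2)) : Set (Site 2 × Fin 2))ᶜ) := by
  rw [determinedBy_iff]
  intro S S' hSS'
  simp only [Set.mem_preimage, Set.mem_setOf_eq]
  refine isPivotal_congr_off_mi A fun e he => ?_
  simp only [Set.mem_insert_iff]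
  by_cases heE : e = eastEdge v
  · simp [heE]
  · rw [mem_cornerConfig_congr_off_coin (forall_iff_of_inter_compl_coin hSS') heE he]

/-- The fair-coin event `{S | (v,0) ∈ S}` is determined by `{(v,0)}`. -/
private theorem determinedBy_coin_mem (v : Site 2) :
    DeterminedBy {S : Set (Site 2 × Fin 2) | (v, (0 : Fin 2)) ∈ S}
      ((↑({(v, (0 : Fin 2))} : Finset (Site 2 × Fin 2)) : Set (Site 2 × Fin 2))) := by
  rw [determinedBy_iff]
  intro S S' h
  have := Set.ext_iff.1 h (v, (0 : Fin 2))
  simpa only [Finset.coe_singleton, Set.mem_inter_iff, Set.mem_singleton_iff, and_true,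
    Set.mem_setOf_eq] using this

/-- The fair-coin event `{S | (v,0) ∉ S}` is determined by `{(v,0)}`. -/
private theorem determinedBy_coin_notMem (v : Site 2) :
    DeterminedBy {S : Set (Site 2 × Fin 2) | (v, (0 : Fin 2)) ∉ S}
      ((↑({(v, (0 : Fin 2))} : Finset (Site 2 × Fin 2)) : Set (Site 2 × Fin 2))) := by
  rw [determinedBy_iff]
  intro S S' h
  have := Set.ext_iff.1 h (v, (0 : Fin 2))
  simp only [Finset.coe_singleton, Set.mem_inter_iff, Set.mem_singleton_iff, and_true] at this
  simp only [Set.mem_setOf_eq, this]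

/-- Through `cornerConfig`, `{E_v ∈ ω}` is the fair coin `{(v,0) ∈ S}`. -/
private theorem preimage_east_mem (v : Site 2) :
    cornerConfig ⁻¹' {ω | eastEdge v ∈ ω} = {S | (v, (0 : Fin 2)) ∈ S} := by
  ext S
  simp only [Set.mem_preimage, Set.mem_setOf_eq, eastEdge, east_mem_cornerConfig_iff]

/-- Through `cornerConfig`, `{E_v ∉ ω}` is the fair-coin event `{(v,0) ∉ S}`. -/
private theorem preimage_east_notMem (v : Site 2) :
    cornerConfig ⁻¹' {ω | eastEdge v ∉ ω} = {S | (v, (0 : Fin 2)) ∉ S} := by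
  ext S
  simp only [Set.mem_preimage, Set.mem_setOf_eq, eastEdge, east_mem_cornerConfig_iff]

/-! ## §4 Integrating out the fair coin -/

/-- **Integrating out the fair coin, `E_v` closed**: for a measurable event `G` whose
coin-space preimage does not depend on the coin `(v,0)`, `M_t({E_v ∉ ω} ∩ G) = ½ M_t(G)`. -/
private theorem real_eastNotMem_inter (t : unitInterval) (v : Site 2)
    {G : Set (BondConfig (Site 2))} (hGm : MeasurableSet G)
    (hG : DeterminedBy (cornerConfig ⁻¹' G)
      ((↑({(v, (0 : Fin 2))} : Finset (Site 2 × Fin 2)) : Set (Site 2 × Fin 2))ᶜ)) :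
    (cornerPercolation t).real ({ω | eastEdge v ∉ ω} ∩ G) =
      (1 / 2 : ℝ) * (cornerPercolation t).real G := by
  rw [cornerPercolation_real_apply t ((measurableSet_notMem _).inter hGm),
    cornerPercolation_real_apply t hGm, Set.preimage_inter, preimage_east_notMem,
    prodBernoulli_real_inter_of_determinedBy (cornerParam t) {(v, (0 : Fin 2))}
      (determinedBy_coin_notMem v) hG (measurableSet_notMem _) (measurable_cornerConfig hGm),
    prodBernoulli_real_setOf_notMem, cornerParam_apply_zero, coe_half]
  norm_num

/-- **Integrating out the fair coin, `E_v` open**: for a measurable event `G` whose coin-space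
preimage does not depend on the coin `(v,0)`, `M_t({E_v ∈ ω} ∩ G) = ½ M_t(G)`. -/
private theorem real_eastMem_inter (t : unitInterval) (v : Site 2)
    {G : Set (BondConfig (Site 2))} (hGm : MeasurableSet G)
    (hG : DeterminedBy (cornerConfig ⁻¹' G)
      ((↑({(v, (0 : Fin 2))} : Finset (Site 2 × Fin 2)) : Set (Site 2 × Fin 2))ᶜ)) :
    (cornerPercolation t).real ({ω | eastEdge v ∈ ω} ∩ G) =
      (1 / 2 : ℝ) * (cornerPercolation t).real G := by
  rw [cornerPercolation_real_apply t ((measurableSet_mem _).inter hGm),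
    cornerPercolation_real_apply t hGm, Set.preimage_inter, preimage_east_mem,
    prodBernoulli_real_inter_of_determinedBy (cornerParam t) {(v, (0 : Fin 2))}
      (determinedBy_coin_mem v) hG (measurableSet_mem _) (measurable_cornerConfig hGm),
    prodBernoulli_real_setOf_mem, cornerParam_apply_zero, coe_half]

/-! ## §5 The stub -/

/-- WORKER STUB (W-B) of line `Sketch`: **the Russo integrand integrated out over the fair
coin.** For every `t ∈ [0,1]`, every measurable `A` and every vertex `v`,
`∫ (1 − 2·𝟙{E_v ∈ ω}) 𝟙{N_v pivotal for A} dM_t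
  = ½ (M_t{N_v pivotal for A with E_v forced closed}
       − M_t{N_v pivotal for A with E_v forced open})`. -/
theorem integral_russoIntegrand_eq_half_pivotal_sub : ∀ (t : unitInterval)
    (A : Set (BondConfig (Site 2))), MeasurableSet A → ∀ v : Site 2,
    ∫ ω, russoIntegrand A v ω ∂(cornerPercolation t) =
      (1 / 2 : ℝ) * ((cornerPercolation t).real {ω | IsPivotal A (northEdge v) (ω \ {eastEdge v})} -
        (cornerPercolation t).real {ω | IsPivotal A (northEdge v) (insert (eastEdge v) ω)}) := by
  intro t A hA v
  have hG₀ : MeasurableSet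
      {ω : BondConfig (Site 2) | IsPivotal A (northEdge v) (ω \ {eastEdge v})} :=
    measurableSet_isPivotal_sdiff_mi hA _ _
  have hG₁ : MeasurableSet
      {ω : BondConfig (Site 2) | IsPivotal A (northEdge v) (insert (eastEdge v) ω)} :=
    measurableSet_isPivotal_insert_mi hA _ _
  have hpt : (fun ω => russoIntegrand A v ω) = fun ω =>
      ({ω | eastEdge v ∉ ω} ∩ {ω | IsPivotal A (northEdge v) (ω \ {eastEdge v})}).indicator
          (1 : BondConfig (Site 2) → ℝ) ω -
        ({ω | eastEdge v ∈ ω} ∩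
            {ω | IsPivotal A (northEdge v) (insert (eastEdge v) ω)}).indicator
          (1 : BondConfig (Site 2) → ℝ) ω :=
    funext fun ω => russoIntegrand_eq_indicator_sub A v ω
  rw [hpt, integral_indicator_one_sub_mi _ ((measurableSet_notMem _).inter hG₀)
      ((measurableSet_mem _).inter hG₁),
    real_eastNotMem_inter t v hG₀ (determinedBy_pivotal_sdiff A v),
    real_eastMem_inter t v hG₁ (determinedBy_pivotal_insert A v)]
  ring

end Summit.CriticalPhenomena.CardyFormulaZ2.Cruxes.UniformMarginality.HeatFlow
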